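import Mathlib.Analysis.Normed.Module.FiniteDimension
import Mathlib.LinearAlgebra.AffineSpace.Independent
import Mathlib.Analysis.Normed.Affine.AddTorsorBases
import HarnessLib

/-!
# Uniformly non-degenerate simplices

A quantitative form of affine independence for a finite point configuration `t` in a real
normed space: `Nondegenerate c t` says that for all weights `w` on `t` with `∑ w = 0`,
`c * |w v| * ‖u - u'‖ ≤ ‖∑ x ∈ t, w x • x‖` for all `v u u' ∈ t` — i.e. `c · max |w| · diam t`
is a lower bound for the norm of the balanced combination.  This is (a basis-free version of)
the *thickness* of a simplex, Munkres, *Elementary differential topology* (1966), 9.2, in the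
form in which it enters the `C¹` estimate for secant maps (Munkres 9.3): it is invariant under
translations and homotheties, positive for every affinely independent configuration
(`exists_pos_nondegenerate`), and — the point of this file — **uniform over all affinely
independent configurations of bounded integer points** (`exists_pos_forall_nondegenerate_of_int`,
a finiteness argument), hence uniform over all simplices with vertices in a lattice
`M⁻¹ ℤᴺ` and diameter `O(M⁻¹)` (`nondegenerate_of_lattice`).  This replaces the "finitely many
shapes" argument of Munkres 9.4 for the standard subdivision.

All statements are elementary and tagged `[folklore]`; no named facts are introduced.
-/

open Set Function

noncomputable section

namespace Literature.Analysis.Convexity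

section General

variable {V : Type*} [NormedAddCommGroup V] [NormedSpace ℝ V]

/-- `Nondegenerate c t`: the finite configuration `t` is `c`-non-degenerate — for all weights
`w` with `∑ x ∈ t, w x = 0` and all `v u u' ∈ t`, `c * |w v| * ‖u - u'‖ ≤ ‖∑ x ∈ t, w x • x‖`
(so `c · max |w| · diam t ≤ ‖∑ w x • x‖`). A basis-free thickness (Munkres (1966), 9.2).
[folklore] -/
def Nondegenerate (c : ℝ) (t : Finset V) : Prop :=
  ∀ w : V → ℝ, ∑ x ∈ t, w x = 0 → ∀ v ∈ t, ∀ u ∈ t, ∀ u' ∈ t,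
    c * |w v| * ‖u - u'‖ ≤ ‖∑ x ∈ t, w x • x‖

/-- Unfolding lemma for `Nondegenerate`. [folklore] -/
theorem nondegenerate_iff {c : ℝ} {t : Finset V} : Nondegenerate c t ↔
    ∀ w : V → ℝ, ∑ x ∈ t, w x = 0 → ∀ v ∈ t, ∀ u ∈ t, ∀ u' ∈ t,
      c * |w v| * ‖u - u'‖ ≤ ‖∑ x ∈ t, w x • x‖ := Iff.rfl

/-- Non-degeneracy is monotone in the constant. [folklore] -/
theorem Nondegenerate.mono {c c' : ℝ} {t : Finset V} (h : Nondegenerate c t) (hc : c' ≤ c) :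
    Nondegenerate c' t := fun w hw v hv u hu u' hu' =>
  (mul_le_mul_of_nonneg_right (mul_le_mul_of_nonneg_right hc (abs_nonneg _)) (norm_nonneg _)).trans
    (h w hw v hv u hu u' hu')

/-- Configurations with at most one point are non-degenerate for every constant. [folklore] -/
theorem nondegenerate_of_card_le_one {c : ℝ} {t : Finset V} (ht : t.card ≤ 1) :
    Nondegenerate c t := by
  intro w hw v hv u hu u' hu'
  have h1 : u = u' := Finset.card_le_one.1 ht u hu u' hu'
  rw [h1, sub_self, norm_zero, mul_zero]
  exact norm_nonneg _

/-- **Affinely independent configurations are non-degenerate.** If `t` is affinely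
independent then `Nondegenerate c t` for some `c > 0`: the linear map `w ↦ ∑ w x • x` is
injective on the hyperplane `∑ w = 0` of the finite-dimensional space of weights, hence bounded
below there (`LinearMap.exists_antilipschitzWith`). [folklore] -/
theorem exists_pos_nondegenerate {t : Finset V} (ht : AffineIndependent ℝ ((↑) : t → V)) :
    ∃ c > 0, Nondegenerate c t := by
  classical
  -- the linear map `Λ w = ∑ w x • x` on weights `t → ℝ`, restricted to `∑ w = 0`
  let Λ : (t → ℝ) →ₗ[ℝ] V := Fintype.linearCombination ℝ (fun x : t => (x : V))
  let σ : (t → ℝ) →ₗ[ℝ] ℝ := Fintype.linearCombination ℝ (fun _ : t => (1 : ℝ))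
  let H : Submodule ℝ (t → ℝ) := LinearMap.ker σ
  let ΛH : H →ₗ[ℝ] V := Λ.comp H.subtype
  have hσ : ∀ w : t → ℝ, σ w = ∑ x, w x := fun w => by
    simp [σ, Fintype.linearCombination_apply]
  have hΛ : ∀ w : t → ℝ, Λ w = ∑ x, w x • (x : V) := fun w => by
    simp [Λ, Fintype.linearCombination_apply]
  have hker : LinearMap.ker ΛH = ⊥ := by
    rw [LinearMap.ker_eq_bot']
    rintro ⟨w, hw⟩ h0
    have hw0 : ∑ x, w x = 0 := by rw [← hσ]; exact hw
    have hΛ0 : ∑ x, w x • (x : V) = 0 := by rw [← hΛ]; exact h0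
    have := ht.eq_zero_of_sum_eq_zero (s := Finset.univ) hw0 hΛ0
    ext x
    exact this x (Finset.mem_univ x)
  obtain ⟨K, hK, hanti⟩ := ΛH.exists_antilipschitzWith hker
  -- the constant
  set S : ℝ := ∑ x ∈ t, ‖x‖ with hS
  have hS0 : 0 ≤ S := Finset.sum_nonneg fun _ _ => norm_nonneg _
  refine ⟨1 / (K * (2 * S + 1)), by positivity, ?_⟩
  intro w hw v hv u hu u' hu'
  -- restrict the weights to `t`
  let w' : t → ℝ := fun x => w x
  have hw' : w' ∈ H := by
    show σ w' = 0
    rw [hσ]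
    have : ∑ x : t, w' x = ∑ x ∈ t, w x := Finset.sum_coe_sort t w
    rw [this, hw]
  have hΛw : ΛH ⟨w', hw'⟩ = ∑ x ∈ t, w x • x := by
    show Λ w' = _
    rw [hΛ]
    exact Finset.sum_coe_sort t (fun x => w x • x)
  -- `|w v| ≤ ‖w'‖ ≤ K * ‖Λ w'‖`
  have h1 : |w v| ≤ K * ‖∑ x ∈ t, w x • x‖ := by
    have hn : ‖(⟨w', hw'⟩ : H)‖ ≤ K * ‖ΛH ⟨w', hw'⟩‖ := by
      simpa using hanti.le_mul_dist ⟨w', hw'⟩ 0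
    rw [hΛw] at hn
    have hv' : |w v| ≤ ‖(⟨w', hw'⟩ : H)‖ := by
      have : |w' ⟨v, hv⟩| ≤ ‖w'‖ := by
        rw [← Real.norm_eq_abs]
        exact norm_le_pi_norm w' ⟨v, hv⟩
      exact this
    exact hv'.trans hn
  -- `‖u - u'‖ ≤ 2 S`
  have h2 : ‖u - u'‖ ≤ 2 * S := by
    calc ‖u - u'‖ ≤ ‖u‖ + ‖u'‖ := norm_sub_le _ _
      _ ≤ S + S := add_le_add
          (Finset.single_le_sum (fun x _ => norm_nonneg x) hu)
          (Finset.single_le_sum (fun x _ => norm_nonneg x) hu')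
      _ = 2 * S := by ring
  set A : ℝ := ‖∑ x ∈ t, w x • x‖ with hA
  have hA0 : 0 ≤ A := norm_nonneg _
  calc 1 / (K * (2 * S + 1)) * |w v| * ‖u - u'‖
      ≤ 1 / (K * (2 * S + 1)) * (K * A) * (2 * S) := by
        gcongr
    _ = A * (2 * S / (2 * S + 1)) := by
        field_simp
    _ ≤ A * 1 := by
        gcongr
        rw [div_le_one (by positivity)]
        linarith
    _ = A := mul_one A

/-- **Invariance under homothety and translation** (the direction needed): if the configuration
`x ↦ M • (x - v₀)` (`M ≠ 0`) applied to `t` is `c`-non-degenerate, so is `t`. [folklore] -/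
theorem Nondegenerate.of_image_smul_sub [DecidableEq V] {c M : ℝ} (hM : M ≠ 0) (v₀ : V)
    {t : Finset V} (h : Nondegenerate c (t.image fun x => M • (x - v₀))) : Nondegenerate c t := by
  intro w hw v hv u hu u' hu'
  set φ : V → V := fun x => M • (x - v₀) with hφ
  have hφinj : Injective φ := fun x y hxy => by
    have := smul_right_injective V hM hxy
    simpa using this
  -- transported weights
  set w' : V → ℝ := fun y => w (M⁻¹ • y + v₀) with hw'
  have hw'φ : ∀ x, w' (φ x) = w x := fun x => by
    simp [hw', hφ, smul_smul, inv_mul_cancel₀ hM]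
  have hsum : ∑ y ∈ t.image φ, w' y = 0 := by
    rw [Finset.sum_image fun x _ y _ h => hφinj h]
    simp_rw [hw'φ]
    exact hw
  have hcomb : ∑ y ∈ t.image φ, w' y • y = M • ∑ x ∈ t, w x • x := by
    rw [Finset.sum_image fun x _ y _ h => hφinj h]
    simp_rw [hw'φ, hφ, smul_sub, Finset.sum_sub_distrib, smul_comm (w _) M, ← Finset.smul_sum,
      ← Finset.sum_smul, hw, zero_smul, smul_zero, sub_zero]
  have key := h w' hsum (φ v) (Finset.mem_image_of_mem φ hv) (φ u) (Finset.mem_image_of_mem φ hu)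
    (φ u') (Finset.mem_image_of_mem φ hu')
  rw [hw'φ, hcomb, norm_smul] at key
  have hφd : ‖φ u - φ u'‖ = ‖M‖ * ‖u - u'‖ := by
    rw [hφ]
    simp only
    rw [← smul_sub, sub_sub_sub_cancel_right, norm_smul]
  rw [hφd] at key
  have hM' : 0 < ‖M‖ := norm_pos_iff.2 hM
  have : ‖M‖ * (c * |w v| * ‖u - u'‖) ≤ ‖M‖ * ‖∑ x ∈ t, w x • x‖ := by
    calc ‖M‖ * (c * |w v| * ‖u - u'‖) = c * |w v| * (‖M‖ * ‖u - u'‖) := by ring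
      _ ≤ ‖M‖ * ‖∑ x ∈ t, w x • x‖ := key
  exact le_of_mul_le_mul_left this hM'

end General

/-! ### Uniformity over bounded integer configurations and lattice simplices -/

section Lattice

variable {N : ℕ}

/-- **Uniform non-degeneracy of bounded integer configurations.** For every `N` and `B` there
is `c > 0` such that every affinely independent configuration of points of `ℝᴺ` with integer
coordinates of absolute value `≤ B` is `c`-non-degenerate — there are only finitely many such
configurations. [folklore] -/
theorem exists_pos_forall_nondegenerate_of_int (N B : ℕ) :
    ∃ c > 0, ∀ t : Finset (Fin N → ℝ), (∀ v ∈ t, ∀ i, ∃ z : ℤ, |z| ≤ B ∧ v i = z) →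
      AffineIndependent ℝ ((↑) : t → (Fin N → ℝ)) → Nondegenerate c t := by
  classical
  -- the finite box of admissible points and the finite family of admissible configurations
  let box : Finset (Fin N → ℝ) :=
    Fintype.piFinset fun _ : Fin N => (Finset.Icc (-(B : ℤ)) B).image fun z : ℤ => (z : ℝ)
  have hbox : ∀ t : Finset (Fin N → ℝ), (∀ v ∈ t, ∀ i, ∃ z : ℤ, |z| ≤ B ∧ v i = z) →
      t ∈ box.powerset := fun t ht => by
    refine Finset.mem_powerset.2 fun v hv => Fintype.mem_piFinset.2 fun i => ?_
    obtain ⟨z, hz, hvz⟩ := ht v hv i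
    refine Finset.mem_image.2 ⟨z, Finset.mem_Icc.2 (abs_le.1 hz), hvz.symm⟩
  -- a positive constant for each configuration
  let φ : Finset (Fin N → ℝ) → ℝ := fun t =>
    if h : AffineIndependent ℝ ((↑) : t → (Fin N → ℝ)) then
      Classical.choose (exists_pos_nondegenerate h) else 1
  have hφpos : ∀ t : Finset (Fin N → ℝ), 0 < φ t := fun t => by
    by_cases h : AffineIndependent ℝ ((↑) : t → (Fin N → ℝ))
    · simp only [φ, dif_pos h]
      exact (Classical.choose_spec (exists_pos_nondegenerate h)).1
    · simp only [φ, dif_neg h]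
      exact one_pos
  have hφnd : ∀ t : Finset (Fin N → ℝ),
      AffineIndependent ℝ ((↑) : t → (Fin N → ℝ)) → Nondegenerate (φ t) t :=
    fun t h => by
      simp only [φ, dif_pos h]
      exact (Classical.choose_spec (exists_pos_nondegenerate h)).2
  have hne : (box.powerset.image φ).Nonempty := ⟨φ ∅, Finset.mem_image.2 ⟨∅, by simp, rfl⟩⟩
  refine ⟨(box.powerset.image φ).min' hne, ?_, fun t ht hind => ?_⟩
  · obtain ⟨t, -, h⟩ := Finset.mem_image.1 ((box.powerset.image φ).min'_mem hne)
    rw [← h]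
    exact hφpos t
  · exact (hφnd t hind).mono (Finset.min'_le _ _ (Finset.mem_image_of_mem φ (hbox t ht)))

/-- **Lattice simplices are uniformly non-degenerate.** Let `c` be the constant of
`exists_pos_forall_nondegenerate_of_int N B`. Then every affinely independent configuration
`t ⊆ ℝᴺ` whose points lie in the lattice `M⁻¹ ℤᴺ` (`M > 0`) and whose coordinates differ
pairwise by at most `B / M` is `c`-non-degenerate (rescale by `M` about a vertex). [folklore] -/
theorem nondegenerate_of_lattice {B : ℕ} {c : ℝ}
    (hc : ∀ t : Finset (Fin N → ℝ), (∀ v ∈ t, ∀ i, ∃ z : ℤ, |z| ≤ B ∧ v i = z) →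
      AffineIndependent ℝ ((↑) : t → (Fin N → ℝ)) → Nondegenerate c t)
    {M : ℝ} (hM : 0 < M) {t : Finset (Fin N → ℝ)}
    (hind : AffineIndependent ℝ ((↑) : t → (Fin N → ℝ)))
    (hlat : ∀ v ∈ t, ∀ i, ∃ z : ℤ, M * v i = z)
    (hdiam : ∀ u ∈ t, ∀ u' ∈ t, ∀ i, M * |u i - u' i| ≤ B) : Nondegenerate c t := by
  classical
  rcases t.eq_empty_or_nonempty with rfl | ⟨v₀, hv₀⟩
  · exact nondegenerate_of_card_le_one (by simp)
  refine Nondegenerate.of_image_smul_sub hM.ne' v₀ (hc _ ?_ ?_)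
  · -- integrality and boundedness of the rescaled configuration
    intro v hv i
    obtain ⟨x, hx, rfl⟩ := Finset.mem_image.1 hv
    obtain ⟨z, hz⟩ := hlat x hx i
    obtain ⟨z₀, hz₀⟩ := hlat v₀ hv₀ i
    refine ⟨z - z₀, ?_, ?_⟩
    · have h := hdiam x hx v₀ hv₀ i
      have : ((z - z₀ : ℤ) : ℝ) = M * (x i - v₀ i) := by
        push_cast
        rw [mul_sub, hz, hz₀]
      have habs : |((z - z₀ : ℤ) : ℝ)| ≤ B := by
        rw [this, abs_mul, abs_of_pos hM]
        exact h
      exact_mod_cast habs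
    · simp only [Pi.smul_apply, Pi.sub_apply, smul_eq_mul]
      push_cast
      rw [mul_sub, hz, hz₀]
  · -- affine independence is preserved by the homothety-translation (an affine equivalence)
    let e : (Fin N → ℝ) ≃ᵃ[ℝ] (Fin N → ℝ) :=
      (AffineEquiv.homothetyUnitsMulHom v₀ (Units.mk0 M hM.ne')).trans
        (AffineEquiv.constVAdd ℝ (Fin N → ℝ) (-v₀))
    have he : ∀ x, e x = M • (x - v₀) := fun x => by
      simp only [e, AffineEquiv.trans_apply, AffineEquiv.coe_homothetyUnitsMulHom_apply,
        AffineMap.homothety_apply, AffineEquiv.constVAdd_apply, vsub_eq_sub, vadd_eq_add,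
        Units.val_mk0]
      abel
    have himg : ((t.image fun x => M • (x - v₀) : Finset (Fin N → ℝ)) : Set (Fin N → ℝ)) =
        e '' (t : Set (Fin N → ℝ)) := by
      rw [Finset.coe_image]
      exact Set.image_congr fun x _ => (he x).symm
    have h := (e.affineIndependent_set_of_eq_iff (s := (t : Set (Fin N → ℝ)))).2 hind
    rwa [← himg] at h

end Lattice

end Literature.Analysis.Convexity
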